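import Mathlib
import HarnessLib
import Summits.Ventures.LatticeQCDFlow.Exactness.SpreadingKernelDoeblin
import Summits.Ventures.LatticeQCDFlow.Exactness.HaarBoxMinorants

/-!
# An exact update on a compact-group lattice that dominates product Haar on a box around every configuration, followed by ANY exact step, converges from every start

HONEST FRAMING: exact (Metropolis-corrected) sampling algorithms for lattice gauge theory;
figures of merit are autocorrelation/cost numbers at stated couplings and volumes; no
continuum-physics claim.

Venture `LatticeQCDFlow` (cell pub-lqcd), topic `Exactness`, FANOUT row 9 (eng-latcore, the engine's
composites `latflow.core.updates.composite_sweep(f, β, 'metro' | 'hmc', n_or)`: an exact update then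
`n_or` over-relaxation sweeps).  NEW WORK of the cell over the tree (`SpreadingKernelDoeblin.lean`: a
locally spreading exact kernel interleaved with any exact Markov kernel has a Doeblin power on a compact
preconnected pseudo-metric space; `HaarBoxMinorants.lean`: boxes, the ball in the box, the Gibbs comparisons;
`GroupMetropolisLinkErgodic.lean`: `gibbsProbability`) and Mathlib (the compatible pseudo-metric
`TopologicalSpace.pseudoMetrizableSpacePseudoMetric`).  Nothing is cited as a fact; no number is claimed.

THE BRIDGE between the tree's minorants and `SpreadingKernelDoeblin.lean`.  The tree's Metropolis and HMC
files prove minorants of the shape `K(U, ·) ≥ δ · mulWalk (⊗ρ) U` (a random kick of every link by laws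
`ρ_j` dominating Haar near `1`) — on the configuration space `ι → G` that is product Haar restricted to the
BOX `{W : W_j U_j⁻¹ ∈ V'}` around `U`; in any pseudo-metric compatible with the topology of the compact
group a ball `B(U, r)` of ONE radius sits in that box for every `U`; and the Gibbs law of a pinched weight
is comparable to product Haar.  So such a `K` SPREADS LOCALLY for the Gibbs law, and
`spreading_comp_uniformlyErgodic` applies with ANY exact interleaved step.

* (the box bookkeeping — `mulWalk_pi_restrict_box`, `smul_restrict_box_le_mulWalk_pi`, `exists_ball_subset_box`,
  the Gibbs comparisons — is `HaarBoxMinorants.lean`) **`spreads_of_box_minorised`** — a kernel with `κ • (⊗Haar)|_{box(U)} ≤ K U` for all `U`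
  (one open `V' ∋ 1`, one `κ ≠ 0`) satisfies `c • π|_{B(U, r)} ≤ K U` for the Gibbs law `π` of a pinched
  weight, in the pseudo-metric `pseudoMetrizableSpacePseudoMetric G`, and `π` charges every ball;
  **`exactStep_uniformlyErgodic_of_box_minorised`** / **`'`** — if moreover `K` is Markov and leaves `π`
  invariant, `G` is connected and `P` is ANY Markov kernel leaving `π` invariant, then
  `|μ₀ (P ∘ₖ K)ᵗ(A) − π(A)| ≤ (1 − ε)^{⌊t/(mm+1)⌋}` (some `mm`, `ε ∈ (0, 1]`; EVERY `μ₀`, `t`, `A`) and `π`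
  is the unique invariant probability law of `P ∘ₖ K`; the same for `K ∘ₖ P`.

NOT CLAIMED: any value of `mm`, `ε`; the instances (Metropolis sweep: `MetropolisSweepExactStepErgodic.lean`;
`SU(N)` 'metro'/'hmc' + 'or': `SUNMetropolisORSweepErgodic.lean`, `SUNLeapfrogHMCORSweepErgodic.lean`);
floating point.
-/

noncomputable section

namespace Summit.Ventures.LatticeQCDFlow.Exactness

open MeasureTheory Measure Metric Set Filter Topology Function ProbabilityTheory ProbabilityTheory.Kernel
open Literature.MathematicalPhysics.QuantumFieldTheory (haarProbability)
open scoped ENNReal Uniformity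

/-! ## Box minorants spread locally; the composite converges -/

section Spread

variable {ι : Type*} [Fintype ι] {G : Type*} [TopologicalSpace G] [Group G] [IsTopologicalGroup G]
  [CompactSpace G] [MeasurableSpace G] [BorelSpace G] [SecondCountableTopology G]
  [TopologicalSpace.PseudoMetrizableSpace G] {w : (ι → G) → ℝ} {m M : ℝ}

omit [SecondCountableTopology G] in
/-- **A BOX MINORANT SPREADS LOCALLY FOR THE GIBBS LAW**, in the compatible pseudo-metric
`pseudoMetrizableSpacePseudoMetric G`: if `κ • (⊗Haar)|_{box(U)} ≤ K U` for every `U` (one open `V' ∋ 1`,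
one `κ ≠ 0`) and the weight is pinched `0 < m ≤ w ≤ M`, then `c • π|_{B(U, r)} ≤ K U` for every `U` for
some `r > 0`, `c ≠ 0`, `π = Z⁻¹ w · Haar^{⊗ι}`, and `π` charges every ball. -/
theorem spreads_of_box_minorised (hm : 0 < m) (hwm : ∀ U, m ≤ w U) (hwM : ∀ U, w U ≤ M)
    {K : Kernel (ι → G) (ι → G)} {V' : Set G} (hV'o : IsOpen V') (hV'1 : (1 : G) ∈ V') {κ : ℝ≥0∞} (hκ : κ ≠ 0)
    (hbox : ∀ U : ι → G,
      κ • (Measure.pi fun _ : ι => haarProbability G).restrict {W | ∀ j, W j * (U j)⁻¹ ∈ V'} ≤ K U) :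
    letI : PseudoMetricSpace G := TopologicalSpace.pseudoMetrizableSpacePseudoMetric G
    ∃ r : ℝ, 0 < r ∧ ∃ c : ℝ≥0∞, c ≠ 0 ∧
      (∀ U : ι → G, c • (gibbsProbability (Measure.pi fun _ : ι => haarProbability G) w).restrict (ball U r) ≤ K U) ∧
      ∀ (U : ι → G) (ρ : ℝ), 0 < ρ →
        gibbsProbability (Measure.pi fun _ : ι => haarProbability G) w (ball U ρ) ≠ 0 := by
  letI : PseudoMetricSpace G := TopologicalSpace.pseudoMetrizableSpacePseudoMetric G
  obtain ⟨r, hr, hball⟩ := exists_ball_subset_box (ι := ι) rfl hV'o hV'1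
  set μ : Measure (ι → G) := Measure.pi fun _ : ι => haarProbability G with hμ
  have hZ := gibbs_partition_ne (μ := μ) hm hwm hwM
  have hM : 0 < M := hm.trans_le ((hwm fun _ => 1).trans (hwM _))
  set d : ℝ≥0∞ := ((μ.withDensity fun x => ENNReal.ofReal (w x)) univ)⁻¹ * ENNReal.ofReal M with hd
  have hd0 : d ≠ 0 := mul_ne_zero (ENNReal.inv_ne_zero.2 hZ.2) (by rw [Ne, ENNReal.ofReal_eq_zero, not_le]; exact hM)
  have hdtop : d ≠ ⊤ := ENNReal.mul_ne_top (ENNReal.inv_ne_top.2 hZ.1) ENNReal.ofReal_ne_top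
  have hπle : gibbsProbability μ w ≤ d • μ := gibbsProbability_le_smul μ hwM
  refine ⟨r, hr, κ * d⁻¹, mul_ne_zero hκ (ENNReal.inv_ne_zero.2 hdtop), fun U => ?_, fun U ρ hρ => ?_⟩
  · calc (κ * d⁻¹) • (gibbsProbability μ w).restrict (ball U r) ≤ κ • μ.restrict (ball U r) := by
          rw [← smul_smul]
          refine Measure.le_iff.2 fun E hE => ?_
          simp only [Measure.smul_apply, smul_eq_mul, Measure.restrict_apply hE]
          refine mul_le_mul' le_rfl ?_
          calc d⁻¹ * gibbsProbability μ w (E ∩ ball U r) ≤ d⁻¹ * (d * μ (E ∩ ball U r)) := by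
                refine mul_le_mul' le_rfl ?_
                have h := Measure.le_iff'.1 hπle (E ∩ ball U r)
                rwa [Measure.smul_apply, smul_eq_mul] at h
            _ = μ (E ∩ ball U r) := by rw [← mul_assoc, ENNReal.inv_mul_cancel hd0 hdtop, one_mul]
      _ ≤ κ • μ.restrict {W | ∀ j, W j * (U j)⁻¹ ∈ V'} := by
          refine Measure.le_iff'.2 fun E => ?_
          simp only [Measure.smul_apply, smul_eq_mul]
          exact mul_le_mul' le_rfl (Measure.le_iff'.1 (Measure.restrict_mono (fun W hW => hball U W hW) le_rfl) E)
      _ ≤ K U := hbox U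
  · have hlow := Measure.le_iff'.1 (smul_le_gibbsProbability μ hwm) (ball U ρ)
    rw [Measure.smul_apply, smul_eq_mul] at hlow
    refine fun h0 => ?_
    rw [h0, nonpos_iff_eq_zero, mul_eq_zero] at hlow
    rcases hlow with h | h
    · exact mul_ne_zero (ENNReal.inv_ne_zero.2 hZ.2) (by rw [Ne, ENNReal.ofReal_eq_zero, not_le]; exact hm) h
    · exact (isOpen_ball.measure_ne_zero μ ⟨U, mem_ball_self hρ⟩) h

variable [ConnectedSpace G]

/-- **A BOX-MINORISED EXACT UPDATE FOLLOWED BY ANY EXACT STEP CONVERGES FROM EVERY START, AT EVERY TIME, AND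
HAS THE GIBBS LAW AS ITS ONLY INVARIANT LAW.**  `G` compact connected second-countable pseudo-metrisable;
`π = Z⁻¹ w · Haar^{⊗ι}` with `0 < m ≤ w ≤ M`; `K` Markov, leaving `π` invariant, with
`κ • (⊗Haar)|_{box(U)} ≤ K U` for all `U` (one open `V' ∋ 1`, one `κ ≠ 0`); `P` ANY Markov kernel leaving
`π` invariant.  Then `|μ₀ (P ∘ₖ K)ᵗ(A) − π(A)| ≤ (1 − ε)^{⌊t/(mm+1)⌋}` for some `mm` and `ε ∈ (0, 1]`, EVERY
initial law `μ₀`, every `t`, every `A`; and `π` is the unique invariant probability law of `P ∘ₖ K`. -/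
theorem exactStep_uniformlyErgodic_of_box_minorised (hm : 0 < m) (hwm : ∀ U, m ≤ w U) (hwM : ∀ U, w U ≤ M)
    {K : Kernel (ι → G) (ι → G)} [IsMarkovKernel K]
    (hKinv : Invariant K (gibbsProbability (Measure.pi fun _ : ι => haarProbability G) w))
    {V' : Set G} (hV'o : IsOpen V') (hV'1 : (1 : G) ∈ V') {κ : ℝ≥0∞} (hκ : κ ≠ 0)
    (hbox : ∀ U : ι → G,
      κ • (Measure.pi fun _ : ι => haarProbability G).restrict {W | ∀ j, W j * (U j)⁻¹ ∈ V'} ≤ K U)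
    (P : Kernel (ι → G) (ι → G)) [IsMarkovKernel P]
    (hP : Invariant P (gibbsProbability (Measure.pi fun _ : ι => haarProbability G) w)) :
    ∃ mm : ℕ, ∃ ε : ℝ, 0 < ε ∧ ε ≤ 1 ∧
      (∀ (μ₀ : Measure (ι → G)) [IsProbabilityMeasure μ₀] (t : ℕ) (A : Set (ι → G)),
        |((fun ν' : Measure (ι → G) => ν'.bind (P ∘ₖ K))^[t] μ₀).real A
            - (gibbsProbability (Measure.pi fun _ : ι => haarProbability G) w).real A| ≤ (1 - ε) ^ (t / (mm + 1))) ∧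
      ∀ (π' : Measure (ι → G)) [IsProbabilityMeasure π'],
        Invariant (P ∘ₖ K) π' → π' = gibbsProbability (Measure.pi fun _ : ι => haarProbability G) w := by
  letI : PseudoMetricSpace G := TopologicalSpace.pseudoMetrizableSpacePseudoMetric G
  obtain ⟨r, hr, c, hc, hK, hpos⟩ := spreads_of_box_minorised (ι := ι) hm hwm hwM hV'o hV'1 hκ hbox
  haveI := isProbabilityMeasure_gibbsProbability (μ := Measure.pi fun _ : ι => haarProbability G) hm hwm hwM
  exact spreading_comp_uniformlyErgodic hKinv hP hr hc hK hpos

/-- **ANY EXACT STEP FOLLOWED BY THE BOX-MINORISED UPDATE CONVERGES FROM EVERY START TOO** (`K ∘ₖ P`):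
`|μ₀ (K ∘ₖ P)ᵗ(A) − π(A)| ≤ (1 − ε)^{⌊t/(mm+1)⌋}` and `π` is the unique invariant probability law. -/
theorem exactStep_uniformlyErgodic_of_box_minorised' (hm : 0 < m) (hwm : ∀ U, m ≤ w U) (hwM : ∀ U, w U ≤ M)
    {K : Kernel (ι → G) (ι → G)} [IsMarkovKernel K]
    (hKinv : Invariant K (gibbsProbability (Measure.pi fun _ : ι => haarProbability G) w))
    {V' : Set G} (hV'o : IsOpen V') (hV'1 : (1 : G) ∈ V') {κ : ℝ≥0∞} (hκ : κ ≠ 0)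
    (hbox : ∀ U : ι → G,
      κ • (Measure.pi fun _ : ι => haarProbability G).restrict {W | ∀ j, W j * (U j)⁻¹ ∈ V'} ≤ K U)
    (P : Kernel (ι → G) (ι → G)) [IsMarkovKernel P]
    (hP : Invariant P (gibbsProbability (Measure.pi fun _ : ι => haarProbability G) w)) :
    ∃ mm : ℕ, ∃ ε : ℝ, 0 < ε ∧ ε ≤ 1 ∧
      (∀ (μ₀ : Measure (ι → G)) [IsProbabilityMeasure μ₀] (t : ℕ) (A : Set (ι → G)),
        |((fun ν' : Measure (ι → G) => ν'.bind (K ∘ₖ P))^[t] μ₀).real A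
            - (gibbsProbability (Measure.pi fun _ : ι => haarProbability G) w).real A| ≤ (1 - ε) ^ (t / (mm + 1))) ∧
      ∀ (π' : Measure (ι → G)) [IsProbabilityMeasure π'],
        Invariant (K ∘ₖ P) π' → π' = gibbsProbability (Measure.pi fun _ : ι => haarProbability G) w := by
  letI : PseudoMetricSpace G := TopologicalSpace.pseudoMetrizableSpacePseudoMetric G
  obtain ⟨r, hr, c, hc, hK, hpos⟩ := spreads_of_box_minorised (ι := ι) hm hwm hwM hV'o hV'1 hκ hbox
  haveI := isProbabilityMeasure_gibbsProbability (μ := Measure.pi fun _ : ι => haarProbability G) hm hwm hwM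
  exact spreading_comp_uniformlyErgodic' hKinv hP hr hc hK hpos

end Spread

end Summit.Ventures.LatticeQCDFlow.Exactness
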